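import Summits.HodgeConjecture.HodgeConjecture.Theorems.F0P6aEReadingsDefs
import HarnessLib

/-!
# `F0P6aEReadingsHecke` — ★ RE-HOME of `Lines/F0_P6a_EReadings.lean`, PART 2 of 3 (size-lint split; cut at a declaration boundary).

## Import provenance
- `Theorems.F0P6aEReadingsDefs` = ★ previous part of the same `Lines` workfile `F0_P6a_EReadings` (size-lint split ×3); `HarnessLib`.

See PART 1 `Theorems/F0P6aEReadingsDefs.lean` for the full re-home header and the original module docstring (verbatim there). Namespaces and sections KEPT
(re-opened below exactly as they stand at the cut, with their `open`∕`variable` lines replayed); code bytes = the workfile՚s, docstrings included; options preamble repeated from PART 1.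
HC_CM is proved only modulo the 7 printed citations (2 remaining: hLiu418 = stmt-HodgeConjecture-24832, h413 = stmt-HodgeConjecture-24833) until rung 0 closes; a re-home is count-neutral. -/

set_option autoImplicit false

noncomputable section

namespace Summit.HodgeConjecture.HodgeConjecture.Cruxes.HLiu418.F0P6aEReadings
set_option linter.dupNamespace false  -- `Summit.HodgeConjecture.HodgeConjecture.…` BY DESIGN (D-0017)
open CategoryTheory CategoryTheory.Limits NumberField IsDedekindDomain MulAction
open scoped Matrix Polynomial Pointwise
open Literature.NumberTheory.GaloisRepresentations
open Literature.NumberTheory.Automorphic Literature.NumberTheory.Automorphic.UnitaryGroup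
open Literature.AlgebraicGeometry.ShimuraVarieties.UnitaryCanonicalModel
open Literature.NumberTheory.Automorphic.Liu2021.AppendixC
open Literature.AlgebraicGeometry.Motives (AlgPoints ComplexPoints IntegralModel SchemeOver thickening thickeningGalAction thickeningLift
  thickeningπ baseChange specOver)
open Literature.AlgebraicGeometry.AbelianSchemes (AbelianSchemeOver)
open Literature.AlgebraicGeometry.AbelianSchemes.AbelianSchemeOver (fibreHom RingAction)
open Literature.NumberTheory.DiophantineGeometry (geomResidueField specialFibreFunctor)
open Literature.AlgebraicGeometry.RelativeSpec (ActionOver)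
open Literature.NumberTheory.EllipticCurves (genericFibre)
open Summit.HodgeConjecture.HodgeConjecture.Cruxes.HLiu418.F0P6aModuliDatumDefs
open Summit.HodgeConjecture.HodgeConjecture.Cruxes.HLiu418.F0P6aRGDAssembly
open Summit.HodgeConjecture.HodgeConjecture.Cruxes.HLiu418.F0P6aPELWitnessE (PELWitnessE IsCMTypeThrough)
open Summit.HodgeConjecture.HodgeConjecture.Cruxes.HLiu418.F0P6aIsomSchemeFiniteType (TupleIsoAt₂)


/-! ### §3 The two transport SOCKETS (letters by value, TRUE for every `gen_iso`-related pair of tuples; bodies `sorry` — programme convention: every `sorry` of a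
Lines file is a `stub_*`) and their by-value CONSUMERS `heckeRoofsΩ_of_gen_iso` ∕ `coverΩ_of_gen_iso` (sorry-free; the organs `stub_HECKE` ∕ `stub_TWIST` of the leaf
`F0_P6a_PELSpread` ED. 2 are one-line instances of them at `T.univ … T.E.P.A … T.gen_iso`) -/

/-- **LETTER `RecordHeckeTransport` — HECKE ROOFS TRANSPORT ALONG THE GENERIC READING** (by value; the tuple binders `univ act dual pol lvl A₂ ρ₂ D₂ pol₂ lvl₂` and the
`gen_iso` hypothesis of the KOTT leaf՚s ★ `kottwitzΩ_of_gen_iso` VERBATIM, `ι_η` inlined, made a closed `Prop`): if on every sheet `e′` at every record point `y` the tuple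
over `𝓨` read at `ι_η ∘ ℓ_{e′} y` is isomorphic as a PEL tuple (★ `TupleIsoAt₂`: EXACT level, EXACT `λ`, Poincaré bundle, `𝒪_F`-equivariant) to the X-tuple
`(A₂, ρ₂, D₂, pol₂, lvl₂)` read at `ℓ_{e′} y`, then the E-side Hecke roofs `HeckeRoofsE` of the X-tuple give the Hecke roofs `HeckeRoofsΩ` of the 𝓨-tuple (same
`pChar fDeg`).  WHY TRUE: every clause of `HeckeRoofsΩ` is a statement about the fibres at finitely many `Ω`-points `ι_η ∘ ℓ_{e′}(u x′)`, `ι_η ∘ ℓ_{e′}(T x′)`, their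
`𝒪_F`-actions, `Ω`-point subgroups, level points and EXACT polarisations — all transported by the isomorphisms `gen_iso e′ _` (`schΩOf … y` IS `(univ.baseChange ι_η).baseChange
(ℓ_{e′} y)` and `schEOf … y` IS `A₂.baseChange (ℓ_{e′} y)`, the two objects `TupleIsoAt₂ (ℓ_{e′} y) …` relates — no base-change-composition iso needed); the roof `B, q, c`
is pre-composed with the isomorphisms (★ p847813 `IsogenyRoofTransportAlongIso`, LA4-p02: the per-point core).  WHY IT MIGHT FAIL: only by a currency slip (the `J12` unit
pin travels with `B` unchanged; `dualIsogenyOver` along an iso by ★ `MFKClausesIsoTransport`-type lemmas; size M).  NOT asserted.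
(print: MumfordFogartyKirwan1994, Ch. 7 §2 Definition 7.2 (p. 129) and Definition 7.3 (p. 129)) (print: Kottwitz1992, §5 pp. 389–391)
(print: RapoportSmithlingZhang2020Diagonal, §4.1 p. 17, §4.3 (4.23) p. 21) -/
def RecordHeckeTransport : Prop :=
  ∀ (F : Type) [Field F] [NumberField F] [IsCMField F] (ι₁ : F →+* ℂ)
    (Jstar : Matrix (Fin 2) (Fin 2) F)
    (K₀ : C5.OpenCompactSubgroup ↥(finAdelic ↥(maximalRealSubfield F) F (IsCMField.complexConj F) 2 Jstar))
    (S : RecordSystemGS F Jstar ι₁ K₀) (hU7ₛ : S.HeckeTranslateDefinedOver)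
    (hJ : (Jstar.map (IsCMField.complexConj F))ᵀ = Jstar) (hJu : IsUnit Jstar)
    (Fi : Type) [Field Fi] [NumberField Fi] [Algebra F Fi] (Kc : C5.SmallLevel K₀)
    (𝓜 : IntegralModel (𝓞 F) F ((thickening F Fi).obj (S.M.obj Kc))) (w : HeightOneSpectrum (𝓞 F)) (hw : (IsCMField.complexConj F) • w ≠ w)
    (univ : AbelianSchemeOver (𝓜.localise w).total.left) (act : RingAction (𝓞 F) univ) (dual : univ.DualPair)
    (pol : univ.Polarization dual) (g N : ℕ) (lvl : univ.LevelStructure g N)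
    (A₂ : AbelianSchemeOver ((baseChange F Fi).obj (S.M.obj Kc)).left) (ρ₂ : RingAction (𝓞 F) A₂) (D₂ : A₂.DualPair)
    (pol₂ : A₂.Polarization D₂) (lvl₂ : A₂.LevelStructure g N),
    (∀ (e' : Fi →ₐ[F] AlgebraicClosure (w.adicCompletion F))
      (y : AlgPoints (S.M.obj Kc) (AlgebraicClosure (w.adicCompletion F))),
      letI ιη := (𝓜.localise w).genericIso'.inv.left ≫
        pullback.fst (𝓜.localise w).total.hom
          (Literature.NumberTheory.EllipticCurves.specGenericPoint (HeightOneSpectrum.valuationSubringAtPrime F w) F)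
      TupleIsoAt₂ (thickeningLift e' (S.M.obj Kc) y).left
        (univ.baseChange ιη) (act.baseChange ιη) (dual.baseChange ιη) (pol.baseChange ιη) (lvl.baseChange ιη)
        A₂ ρ₂ D₂ pol₂ lvl₂) →
    ∀ (pChar fDeg : ℕ), HeckeRoofsE S hU7ₛ hJ hJu Kc w hw A₂ ρ₂ D₂ pol₂ lvl₂ pChar fDeg →
      HeckeRoofsΩ S hU7ₛ hJ hJu Kc 𝓜 w hw univ act dual pol lvl pChar fDeg

/-- **LETTER `RecordCoverTransport` — SERRE COVER TRANSPORT ALONG THE GENERIC READING** (by value; same tuple binders and `gen_iso`): the E-side Serre cover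
`CoverE … e … e′ 𝔞 n y` between the sheets `e`, `e′` at `y` gives the cover `CoverΩ … e … e′ 𝔞 n y` of the 𝓨-tuple — conjugate `c`, the `d_a`, `f_b` by the two
isomorphisms `gen_iso e y`, `gen_iso e′ y` ((t1)(t2)(t4) by equivariance, (t3) EXACT `λ` by the polarisation clause of ★ `TupleIsoAt₂` and ★ `dualIsogenyOver` functoriality,
(t5) by the EXACT level clause).  WHY IT MIGHT FAIL: currency only (size S–M).  NOT asserted.
(print: MumfordFogartyKirwan1994, Ch. 7 §2 Definition 7.2 (p. 129)) (print: Shimura1998, §13.1, Theorem 1) (print: RapoportSmithlingZhang2020Diagonal, §3.2 p. 11, §4.3 p. 20) -/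
def RecordCoverTransport : Prop :=
  ∀ (F : Type) [Field F] [NumberField F] [IsCMField F] (ι₁ : F →+* ℂ)
    (Jstar : Matrix (Fin 2) (Fin 2) F)
    (K₀ : C5.OpenCompactSubgroup ↥(finAdelic ↥(maximalRealSubfield F) F (IsCMField.complexConj F) 2 Jstar))
    (S : RecordSystemGS F Jstar ι₁ K₀)
    (Fi : Type) [Field Fi] [NumberField Fi] [Algebra F Fi] (Kc : C5.SmallLevel K₀)
    (𝓜 : IntegralModel (𝓞 F) F ((thickening F Fi).obj (S.M.obj Kc))) (w : HeightOneSpectrum (𝓞 F))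
    (univ : AbelianSchemeOver (𝓜.localise w).total.left) (act : RingAction (𝓞 F) univ) (dual : univ.DualPair)
    (pol : univ.Polarization dual) (g N : ℕ) (lvl : univ.LevelStructure g N)
    (A₂ : AbelianSchemeOver ((baseChange F Fi).obj (S.M.obj Kc)).left) (ρ₂ : RingAction (𝓞 F) A₂) (D₂ : A₂.DualPair)
    (pol₂ : A₂.Polarization D₂) (lvl₂ : A₂.LevelStructure g N),
    (∀ (e' : Fi →ₐ[F] AlgebraicClosure (w.adicCompletion F))
      (y : AlgPoints (S.M.obj Kc) (AlgebraicClosure (w.adicCompletion F))),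
      letI ιη := (𝓜.localise w).genericIso'.inv.left ≫
        pullback.fst (𝓜.localise w).total.hom
          (Literature.NumberTheory.EllipticCurves.specGenericPoint (HeightOneSpectrum.valuationSubringAtPrime F w) F)
      TupleIsoAt₂ (thickeningLift e' (S.M.obj Kc) y).left
        (univ.baseChange ιη) (act.baseChange ιη) (dual.baseChange ιη) (pol.baseChange ιη) (lvl.baseChange ιη)
        A₂ ρ₂ D₂ pol₂ lvl₂) →
    ∀ (e e' : Fi →ₐ[F] AlgebraicClosure (w.adicCompletion F)) (𝔞 : Ideal (𝓞 F)) (n : ℕ)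
      (y : AlgPoints (S.M.obj Kc) (AlgebraicClosure (w.adicCompletion F))),
      CoverE S Kc w e A₂ ρ₂ D₂ pol₂ lvl₂ e' 𝔞 n y → CoverΩ S Kc 𝓜 w e univ act dual pol lvl e' 𝔞 n y

set_option maxHeartbeats 400000 in
/-- (ED. 2 helper) **ONE ROOF TRANSPORTS**: `RoofE … y y″ K → RoofΩ … y y″ φ(K)` along two bridge isomorphisms `ε₁ : E_{e′,y} ≅ 𝒯_{e′,y}`, `ε₁″ : E_{e′,y″} ≅ 𝒯_{e′,y″}`
exact on `λ` (dual-homomorphism form), `ι` and the level points, with `φ` the point equivalence of `ε₁` (`φ⁻¹ = ε₁⁻¹(·)`): ★ p847813 `roof_transport_along_iso` on the readers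
(the clause texts of `RoofE`∕`RoofΩ` ARE its abstract binders; `hK` by ★ `HeckeLines.mem_map_iff_of_symm_eq`, `htors` by ★ `forall_map_eq_one_iff_of_iso_inv`).  Budget
400 000 (the `RoofE`∕`RoofΩ` statements themselves are declared at that budget). [cite: MumfordAV1970, §15 Thm. 1 (p. 143); §23 Thm. 2 (p. 231)]
[cite: MumfordFogartyKirwan1994, Ch. 7 §2 Definition 7.2 (p. 129) and Definition 7.3 (p. 129)] [cite: Kottwitz1992, §5, p. 391] -/
theorem roofΩ_of_roofE {F : Type} [Field F] [NumberField F] [IsCMField F] {ι₁ : F →+* ℂ}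
    {Jstar : Matrix (Fin 2) (Fin 2) F}
    {K₀ : C5.OpenCompactSubgroup ↥(finAdelic ↥(maximalRealSubfield F) F (IsCMField.complexConj F) 2 Jstar)}
    (S : RecordSystemGS F Jstar ι₁ K₀)
    {Fi : Type} [Field Fi] [NumberField Fi] [Algebra F Fi] (Kc : C5.SmallLevel K₀)
    (𝓜 : IntegralModel (𝓞 F) F ((thickening F Fi).obj (S.M.obj Kc))) (w : HeightOneSpectrum (𝓞 F))
    (univ : AbelianSchemeOver (𝓜.localise w).total.left) (act : RingAction (𝓞 F) univ) (dual : univ.DualPair)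
    (pol : univ.Polarization dual) {g N : ℕ} (lvl : univ.LevelStructure g N)
    (A₂ : AbelianSchemeOver ((baseChange F Fi).obj (S.M.obj Kc)).left) (ρ₂ : RingAction (𝓞 F) A₂) (D₂ : A₂.DualPair)
    (pol₂ : A₂.Polarization D₂) (lvl₂ : A₂.LevelStructure g N)
    (e' : Fi →ₐ[F] AlgebraicClosure (w.adicCompletion F)) (pChar : ℕ) (𝔞 : Ideal (𝓞 F))
    (y y'' : AlgPoints (S.M.obj Kc) (AlgebraicClosure (w.adicCompletion F)))
    (ε₁ : (schEOf S Kc w e' A₂ y).X ≅ (schΩOf S Kc 𝓜 w e' univ y).X) [IsMonHom ε₁.hom]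
    (ε₁'' : (schEOf S Kc w e' A₂ y'').X ≅ (schΩOf S Kc 𝓜 w e' univ y'').X) [IsMonHom ε₁''.hom]
    (he : ε₁.hom ≫ (polΩOf S Kc 𝓜 w e' univ pol y).lam ≫
        Literature.AlgebraicGeometry.AbelianSchemes.AbelianSchemeOver.DualPair.dualIsogenyOver ε₁.hom (dualEOf S Kc w e' A₂ D₂ y) (dualΩOf S Kc 𝓜 w e' univ dual y) =
      (polEOf S Kc w e' A₂ pol₂ y).lam)
    (he'' : ε₁''.hom ≫ (polΩOf S Kc 𝓜 w e' univ pol y'').lam ≫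
        Literature.AlgebraicGeometry.AbelianSchemes.AbelianSchemeOver.DualPair.dualIsogenyOver ε₁''.hom (dualEOf S Kc w e' A₂ D₂ y'') (dualΩOf S Kc 𝓜 w e' univ dual y'') =
      (polEOf S Kc w e' A₂ pol₂ y'').lam)
    (hact : ∀ a, (actEOf S Kc w e' A₂ ρ₂ a y).hom.hom.hom ≫ ε₁.hom = ε₁.hom ≫ (actΩOf S Kc 𝓜 w e' univ act a y).hom.hom.hom)
    (hact'' : ∀ a, (actEOf S Kc w e' A₂ ρ₂ a y'').hom.hom.hom ≫ ε₁''.hom = ε₁''.hom ≫ (actΩOf S Kc 𝓜 w e' univ act a y'').hom.hom.hom)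
    (hpt : ∀ a, (AlgPoints.map ε₁.hom (lvlPtEOf S Kc w e' A₂ lvl₂ y a) :
        (fibreΩOf S Kc 𝓜 w e' univ y).Points (AlgebraicClosure (w.adicCompletion F))) = lvlPtΩOf S Kc 𝓜 w e' univ lvl y a)
    (hpt'' : ∀ a, (AlgPoints.map ε₁''.hom (lvlPtEOf S Kc w e' A₂ lvl₂ y'' a) :
        (fibreΩOf S Kc 𝓜 w e' univ y'').Points (AlgebraicClosure (w.adicCompletion F))) = lvlPtΩOf S Kc 𝓜 w e' univ lvl y'' a)
    (φ : (fibreEOf S Kc w e' A₂ y).Points (AlgebraicClosure (w.adicCompletion F)) ≃*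
      (fibreΩOf S Kc 𝓜 w e' univ y).Points (AlgebraicClosure (w.adicCompletion F)))
    (hφsymm : ∀ Q, φ.symm Q = AlgPoints.map ε₁.inv Q)
    (K : Subgroup ((fibreEOf S Kc w e' A₂ y).Points (AlgebraicClosure (w.adicCompletion F))))
    (h : RoofE S Kc w e' A₂ ρ₂ D₂ pol₂ lvl₂ pChar 𝔞 y y'' K) :
    RoofΩ S Kc 𝓜 w e' univ act dual pol lvl pChar 𝔞 y y'' (K.map φ.toMonoidHom) :=
  Literature.AlgebraicGeometry.AbelianSchemes.AbelianSchemeOver.roof_transport_along_iso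
    (dualEOf S Kc w e' A₂ D₂ y) (dualΩOf S Kc 𝓜 w e' univ dual y) (dualEOf S Kc w e' A₂ D₂ y'') (dualΩOf S Kc 𝓜 w e' univ dual y'')
    (polEOf S Kc w e' A₂ pol₂ y).nonempty_unitHatSlice_iso (polΩOf S Kc 𝓜 w e' univ pol y).nonempty_unitHatSlice_iso
    (polEOf S Kc w e' A₂ pol₂ y'').nonempty_unitHatSlice_iso (polΩOf S Kc 𝓜 w e' univ pol y'').nonempty_unitHatSlice_iso
    (polEOf S Kc w e' A₂ pol₂ y).lam (polΩOf S Kc 𝓜 w e' univ pol y).lam (polEOf S Kc w e' A₂ pol₂ y'').lam (polΩOf S Kc 𝓜 w e' univ pol y'').lam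
    (fun a => (actEOf S Kc w e' A₂ ρ₂ a y).hom.hom.hom) (fun a => (actΩOf S Kc 𝓜 w e' univ act a y).hom.hom.hom)
    (fun a => (actEOf S Kc w e' A₂ ρ₂ a y'').hom.hom.hom) (fun a => (actΩOf S Kc 𝓜 w e' univ act a y'').hom.hom.hom)
    (fun a => lvlPtEOf S Kc w e' A₂ lvl₂ y a) (fun a => lvlPtΩOf S Kc 𝓜 w e' univ lvl y a)
    (fun a => lvlPtEOf S Kc w e' A₂ lvl₂ y'' a) (fun a => lvlPtΩOf S Kc 𝓜 w e' univ lvl y'' a)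
    (IsIdealTorsionE S Kc w e' A₂ ρ₂ y'' 𝔞) (IsIdealTorsionΩ S Kc 𝓜 w e' univ act y'' 𝔞)
    K (K.map φ.toMonoidHom) ε₁ ε₁'' pChar he he'' hact hact'' hpt hpt''
    (fun Q => Literature.AlgebraicGeometry.AbelianSchemes.AbelianSchemeOver.forall_map_eq_one_iff_of_iso_inv ε₁'' (· ∈ 𝔞)
      (fun a => (actEOf S Kc w e' A₂ ρ₂ a y'').hom.hom.hom) (fun a => (actΩOf S Kc 𝓜 w e' univ act a y'').hom.hom.hom) hact'' Q)
    (Literature.AlgebraicGeometry.AbelianSchemes.HeckeLines.mem_map_iff_of_symm_eq φ K (fun Q => AlgPoints.map ε₁.inv Q) hφsymm) h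

set_option maxHeartbeats 400000 in
/-- (ED. 2 helper) **ONE `t₁`-LINE TRANSPORTS**: the `H_β`∕`K_β` membership rider (`P ∈ H ↔ P ∈ K ∧ P` is `𝔠`-torsion) and the roof through `K_β` at `(y, y″)` pass from the
E-tuple to the spread along the bridge at `y` (given: `ε₁`, its point equivalence `φ`) and the bridge at `y″` (taken from `gen_iso`). [cite: MumfordAV1970, §15 Thm. 1 (p. 143); §23 Thm. 2 (p. 231)] [cite: Kottwitz1992, §5, p. 391]
[cite: RapoportSmithlingZhang2020Diagonal, §4.3 (4.23) p. 21] -/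
theorem lineRoofΩ_of_E {F : Type} [Field F] [NumberField F] [IsCMField F] {ι₁ : F →+* ℂ}
    {Jstar : Matrix (Fin 2) (Fin 2) F}
    {K₀ : C5.OpenCompactSubgroup ↥(finAdelic ↥(maximalRealSubfield F) F (IsCMField.complexConj F) 2 Jstar)}
    (S : RecordSystemGS F Jstar ι₁ K₀)
    {Fi : Type} [Field Fi] [NumberField Fi] [Algebra F Fi] (Kc : C5.SmallLevel K₀)
    (𝓜 : IntegralModel (𝓞 F) F ((thickening F Fi).obj (S.M.obj Kc))) (w : HeightOneSpectrum (𝓞 F))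
    (univ : AbelianSchemeOver (𝓜.localise w).total.left) (act : RingAction (𝓞 F) univ) (dual : univ.DualPair)
    (pol : univ.Polarization dual) {g N : ℕ} (lvl : univ.LevelStructure g N)
    (A₂ : AbelianSchemeOver ((baseChange F Fi).obj (S.M.obj Kc)).left) (ρ₂ : RingAction (𝓞 F) A₂) (D₂ : A₂.DualPair)
    (pol₂ : A₂.Polarization D₂) (lvl₂ : A₂.LevelStructure g N)
    (gen_iso : ∀ (e' : Fi →ₐ[F] AlgebraicClosure (w.adicCompletion F))
      (y : AlgPoints (S.M.obj Kc) (AlgebraicClosure (w.adicCompletion F))),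
      letI ιη := (𝓜.localise w).genericIso'.inv.left ≫
        pullback.fst (𝓜.localise w).total.hom
          (Literature.NumberTheory.EllipticCurves.specGenericPoint (HeightOneSpectrum.valuationSubringAtPrime F w) F)
      TupleIsoAt₂ (thickeningLift e' (S.M.obj Kc) y).left
        (univ.baseChange ιη) (act.baseChange ιη) (dual.baseChange ιη) (pol.baseChange ιη) (lvl.baseChange ιη)
        A₂ ρ₂ D₂ pol₂ lvl₂)
    (e' : Fi →ₐ[F] AlgebraicClosure (w.adicCompletion F)) (pChar : ℕ) (𝔠 𝔞 : Ideal (𝓞 F))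
    (y y'' : AlgPoints (S.M.obj Kc) (AlgebraicClosure (w.adicCompletion F)))
    (ε₁ : (schEOf S Kc w e' A₂ y).X ≅ (schΩOf S Kc 𝓜 w e' univ y).X) [IsMonHom ε₁.hom]
    (he : ε₁.hom ≫ (polΩOf S Kc 𝓜 w e' univ pol y).lam ≫
        Literature.AlgebraicGeometry.AbelianSchemes.AbelianSchemeOver.DualPair.dualIsogenyOver ε₁.hom (dualEOf S Kc w e' A₂ D₂ y) (dualΩOf S Kc 𝓜 w e' univ dual y) =
      (polEOf S Kc w e' A₂ pol₂ y).lam)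
    (hact : ∀ a, (actEOf S Kc w e' A₂ ρ₂ a y).hom.hom.hom ≫ ε₁.hom = ε₁.hom ≫ (actΩOf S Kc 𝓜 w e' univ act a y).hom.hom.hom)
    (hpt : ∀ a, (AlgPoints.map ε₁.hom (lvlPtEOf S Kc w e' A₂ lvl₂ y a) :
        (fibreΩOf S Kc 𝓜 w e' univ y).Points (AlgebraicClosure (w.adicCompletion F))) = lvlPtΩOf S Kc 𝓜 w e' univ lvl y a)
    (φ : (fibreEOf S Kc w e' A₂ y).Points (AlgebraicClosure (w.adicCompletion F)) ≃*
      (fibreΩOf S Kc 𝓜 w e' univ y).Points (AlgebraicClosure (w.adicCompletion F)))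
    (hφsymm : ∀ Q, φ.symm Q = AlgPoints.map ε₁.inv Q)
    (htors : ∀ P, IsIdealTorsionΩ S Kc 𝓜 w e' univ act y 𝔠 (φ P) ↔ IsIdealTorsionE S Kc w e' A₂ ρ₂ y 𝔠 P)
    (K : Subgroup ((fibreEOf S Kc w e' A₂ y).Points (AlgebraicClosure (w.adicCompletion F))))
    (H : Subgroup ((fibreEOf S Kc w e' A₂ y).Points (AlgebraicClosure (w.adicCompletion F))))
    (hHK : ∀ P, P ∈ H ↔ P ∈ K ∧ IsIdealTorsionE S Kc w e' A₂ ρ₂ y 𝔠 P)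
    (hroof : RoofE S Kc w e' A₂ ρ₂ D₂ pol₂ lvl₂ pChar 𝔞 y y'' K) :
    ∃ K' : Subgroup ((fibreΩOf S Kc 𝓜 w e' univ y).Points (AlgebraicClosure (w.adicCompletion F))),
      (∀ P, P ∈ H.map φ.toMonoidHom ↔ P ∈ K' ∧ IsIdealTorsionΩ S Kc 𝓜 w e' univ act y 𝔠 P) ∧
      RoofΩ S Kc 𝓜 w e' univ act dual pol lvl pChar 𝔞 y y'' K' := by
  -- the bridge at the second point `y″` (★ p848009), then one roof (helper `roofΩ_of_roofE`)
  refine (gen_iso e' y'').elim fun G'' hG₁'' => hG₁''.elim fun Ĝ'' hG'' => ?_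
  refine (Literature.AlgebraicGeometry.AbelianSchemes.AbelianSchemeOver.exists_iso_exact_of_tupleRel_id_point (thickeningLift e' (S.M.obj Kc) y'').left (univ.baseChange ((𝓜.localise w).genericIso'.inv.left ≫ CategoryTheory.Limits.pullback.fst (𝓜.localise w).total.hom (Literature.NumberTheory.EllipticCurves.specGenericPoint (HeightOneSpectrum.valuationSubringAtPrime F w) F))) A₂ (act.baseChange ((𝓜.localise w).genericIso'.inv.left ≫ CategoryTheory.Limits.pullback.fst (𝓜.localise w).total.hom (Literature.NumberTheory.EllipticCurves.specGenericPoint (HeightOneSpectrum.valuationSubringAtPrime F w) F))) ρ₂ (dual.baseChange ((𝓜.localise w).genericIso'.inv.left ≫ CategoryTheory.Limits.pullback.fst (𝓜.localise w).total.hom (Literature.NumberTheory.EllipticCurves.specGenericPoint (HeightOneSpectrum.valuationSubringAtPrime F w) F))) D₂ (pol.baseChange ((𝓜.localise w).genericIso'.inv.left ≫ CategoryTheory.Limits.pullback.fst (𝓜.localise w).total.hom (Literature.NumberTheory.EllipticCurves.specGenericPoint (HeightOneSpectrum.valuationSubringAtPrime F w) F))) pol₂ (lvl.baseChange ((𝓜.localise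 w).genericIso'.inv.left ≫ CategoryTheory.Limits.pullback.fst (𝓜.localise w).total.hom (Literature.NumberTheory.EllipticCurves.specGenericPoint (HeightOneSpectrum.valuationSubringAtPrime F w) F))) lvl₂ hG'').elim fun ε'' hε'' => hε''.elim fun hmon'' hb'' => ?_
  haveI := hmon''
  let ε₁'' : (schEOf S Kc w e' A₂ y'').X ≅ (schΩOf S Kc 𝓜 w e' univ y'').X := ε''.symm
  haveI : IsMonHom ε₁''.hom := (inferInstance : IsMonHom ε''.inv)
  have hlam'' : ε₁''.hom ≫ (polΩOf S Kc 𝓜 w e' univ pol y'').lam ≫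
      Literature.AlgebraicGeometry.AbelianSchemes.AbelianSchemeOver.DualPair.dualIsogenyOver ε₁''.hom (dualEOf S Kc w e' A₂ D₂ y'')
        (dualΩOf S Kc 𝓜 w e' univ dual y'') = (polEOf S Kc w e' A₂ pol₂ y'').lam := hb''.2.2.1
  have hact'' : ∀ a, (actEOf S Kc w e' A₂ ρ₂ a y'').hom.hom.hom ≫ ε₁''.hom = ε₁''.hom ≫ (actΩOf S Kc 𝓜 w e' univ act a y'').hom.hom.hom :=
    hb''.2.2.2.2.1
  have hpt'' : ∀ a, (AlgPoints.map ε₁''.hom (lvlPtEOf S Kc w e' A₂ lvl₂ y'' a) :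
      (fibreΩOf S Kc 𝓜 w e' univ y'').Points (AlgebraicClosure (w.adicCompletion F))) = lvlPtΩOf S Kc 𝓜 w e' univ lvl y'' a :=
    hb''.2.2.2.2.2.2
  exact ⟨K.map φ.toMonoidHom, Literature.AlgebraicGeometry.AbelianSchemes.HeckeLines.mem_map_iff_of_iff_and φ _ _ htors H K hHK, roofΩ_of_roofE S Kc 𝓜 w univ act dual pol lvl A₂ ρ₂ D₂ pol₂ lvl₂ e' pChar 𝔞 y y'' ε₁ ε₁''
    he hlam'' hact hact'' hpt hpt'' φ hφsymm K hroof⟩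

set_option maxHeartbeats 400000 in
/-- (ED. 2 helper) **THE CENTRAL `t₂`-ROOF TRANSPORTS**: the kernel description (`P ∈ K ↔ P` is `𝔠`-torsion) and the roof through `K` at `(y, y″)` pass from the E-tuple to the
spread along the bridge at `y` and the bridge at `y″`. [cite: MumfordAV1970, §15 Thm. 1 (p. 143); §23 Thm. 2 (p. 231)] [cite: Kottwitz1992, §5, p. 391]
[cite: RapoportSmithlingZhang2020Diagonal, §4.3 (4.23) p. 21] -/
theorem centralRoofΩ_of_E {F : Type} [Field F] [NumberField F] [IsCMField F] {ι₁ : F →+* ℂ}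
    {Jstar : Matrix (Fin 2) (Fin 2) F}
    {K₀ : C5.OpenCompactSubgroup ↥(finAdelic ↥(maximalRealSubfield F) F (IsCMField.complexConj F) 2 Jstar)}
    (S : RecordSystemGS F Jstar ι₁ K₀)
    {Fi : Type} [Field Fi] [NumberField Fi] [Algebra F Fi] (Kc : C5.SmallLevel K₀)
    (𝓜 : IntegralModel (𝓞 F) F ((thickening F Fi).obj (S.M.obj Kc))) (w : HeightOneSpectrum (𝓞 F))
    (univ : AbelianSchemeOver (𝓜.localise w).total.left) (act : RingAction (𝓞 F) univ) (dual : univ.DualPair)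
    (pol : univ.Polarization dual) {g N : ℕ} (lvl : univ.LevelStructure g N)
    (A₂ : AbelianSchemeOver ((baseChange F Fi).obj (S.M.obj Kc)).left) (ρ₂ : RingAction (𝓞 F) A₂) (D₂ : A₂.DualPair)
    (pol₂ : A₂.Polarization D₂) (lvl₂ : A₂.LevelStructure g N)
    (gen_iso : ∀ (e' : Fi →ₐ[F] AlgebraicClosure (w.adicCompletion F))
      (y : AlgPoints (S.M.obj Kc) (AlgebraicClosure (w.adicCompletion F))),
      letI ιη := (𝓜.localise w).genericIso'.inv.left ≫
        pullback.fst (𝓜.localise w).total.hom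
          (Literature.NumberTheory.EllipticCurves.specGenericPoint (HeightOneSpectrum.valuationSubringAtPrime F w) F)
      TupleIsoAt₂ (thickeningLift e' (S.M.obj Kc) y).left
        (univ.baseChange ιη) (act.baseChange ιη) (dual.baseChange ιη) (pol.baseChange ιη) (lvl.baseChange ιη)
        A₂ ρ₂ D₂ pol₂ lvl₂)
    (e' : Fi →ₐ[F] AlgebraicClosure (w.adicCompletion F)) (pChar : ℕ) (𝔠 𝔞 : Ideal (𝓞 F))
    (y y'' : AlgPoints (S.M.obj Kc) (AlgebraicClosure (w.adicCompletion F)))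
    (ε₁ : (schEOf S Kc w e' A₂ y).X ≅ (schΩOf S Kc 𝓜 w e' univ y).X) [IsMonHom ε₁.hom]
    (he : ε₁.hom ≫ (polΩOf S Kc 𝓜 w e' univ pol y).lam ≫
        Literature.AlgebraicGeometry.AbelianSchemes.AbelianSchemeOver.DualPair.dualIsogenyOver ε₁.hom (dualEOf S Kc w e' A₂ D₂ y) (dualΩOf S Kc 𝓜 w e' univ dual y) =
      (polEOf S Kc w e' A₂ pol₂ y).lam)
    (hact : ∀ a, (actEOf S Kc w e' A₂ ρ₂ a y).hom.hom.hom ≫ ε₁.hom = ε₁.hom ≫ (actΩOf S Kc 𝓜 w e' univ act a y).hom.hom.hom)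
    (hpt : ∀ a, (AlgPoints.map ε₁.hom (lvlPtEOf S Kc w e' A₂ lvl₂ y a) :
        (fibreΩOf S Kc 𝓜 w e' univ y).Points (AlgebraicClosure (w.adicCompletion F))) = lvlPtΩOf S Kc 𝓜 w e' univ lvl y a)
    (φ : (fibreEOf S Kc w e' A₂ y).Points (AlgebraicClosure (w.adicCompletion F)) ≃*
      (fibreΩOf S Kc 𝓜 w e' univ y).Points (AlgebraicClosure (w.adicCompletion F)))
    (hφsymm : ∀ Q, φ.symm Q = AlgPoints.map ε₁.inv Q)
    (htors : ∀ P, IsIdealTorsionΩ S Kc 𝓜 w e' univ act y 𝔠 (φ P) ↔ IsIdealTorsionE S Kc w e' A₂ ρ₂ y 𝔠 P)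
    (K : Subgroup ((fibreEOf S Kc w e' A₂ y).Points (AlgebraicClosure (w.adicCompletion F))))
    (hK : ∀ P, P ∈ K ↔ IsIdealTorsionE S Kc w e' A₂ ρ₂ y 𝔠 P)
    (hroof : RoofE S Kc w e' A₂ ρ₂ D₂ pol₂ lvl₂ pChar 𝔞 y y'' K) :
    ∃ K' : Subgroup ((fibreΩOf S Kc 𝓜 w e' univ y).Points (AlgebraicClosure (w.adicCompletion F))),
      (∀ P, P ∈ K' ↔ IsIdealTorsionΩ S Kc 𝓜 w e' univ act y 𝔠 P) ∧
      RoofΩ S Kc 𝓜 w e' univ act dual pol lvl pChar 𝔞 y y'' K' := by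
  -- the bridge at the second point `y″` (★ p848009), then one roof (helper `roofΩ_of_roofE`)
  refine (gen_iso e' y'').elim fun G'' hG₁'' => hG₁''.elim fun Ĝ'' hG'' => ?_
  refine (Literature.AlgebraicGeometry.AbelianSchemes.AbelianSchemeOver.exists_iso_exact_of_tupleRel_id_point (thickeningLift e' (S.M.obj Kc) y'').left (univ.baseChange ((𝓜.localise w).genericIso'.inv.left ≫ CategoryTheory.Limits.pullback.fst (𝓜.localise w).total.hom (Literature.NumberTheory.EllipticCurves.specGenericPoint (HeightOneSpectrum.valuationSubringAtPrime F w) F))) A₂ (act.baseChange ((𝓜.localise w).genericIso'.inv.left ≫ CategoryTheory.Limits.pullback.fst (𝓜.localise w).total.hom (Literature.NumberTheory.EllipticCurves.specGenericPoint (HeightOneSpectrum.valuationSubringAtPrime F w) F))) ρ₂ (dual.baseChange ((𝓜.localise w).genericIso'.inv.left ≫ CategoryTheory.Limits.pullback.fst (𝓜.localise w).total.hom (Literature.NumberTheory.EllipticCurves.specGenericPoint (HeightOneSpectrum.valuationSubringAtPrime F w) F))) D₂ (pol.baseChange ((𝓜.localise w).genericIso'.inv.left ≫ CategoryTheory.Limits.pullback.fst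 (𝓜.localise w).total.hom (Literature.NumberTheory.EllipticCurves.specGenericPoint (HeightOneSpectrum.valuationSubringAtPrime F w) F))) pol₂ (lvl.baseChange ((𝓜.localise w).genericIso'.inv.left ≫ CategoryTheory.Limits.pullback.fst (𝓜.localise w).total.hom (Literature.NumberTheory.EllipticCurves.specGenericPoint (HeightOneSpectrum.valuationSubringAtPrime F w) F))) lvl₂ hG'').elim fun ε'' hε'' => hε''.elim fun hmon'' hb'' => ?_
  haveI := hmon''
  let ε₁'' : (schEOf S Kc w e' A₂ y'').X ≅ (schΩOf S Kc 𝓜 w e' univ y'').X := ε''.symm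
  haveI : IsMonHom ε₁''.hom := (inferInstance : IsMonHom ε''.inv)
  have hlam'' : ε₁''.hom ≫ (polΩOf S Kc 𝓜 w e' univ pol y'').lam ≫
      Literature.AlgebraicGeometry.AbelianSchemes.AbelianSchemeOver.DualPair.dualIsogenyOver ε₁''.hom (dualEOf S Kc w e' A₂ D₂ y'')
        (dualΩOf S Kc 𝓜 w e' univ dual y'') = (polEOf S Kc w e' A₂ pol₂ y'').lam := hb''.2.2.1
  have hact'' : ∀ a, (actEOf S Kc w e' A₂ ρ₂ a y'').hom.hom.hom ≫ ε₁''.hom = ε₁''.hom ≫ (actΩOf S Kc 𝓜 w e' univ act a y'').hom.hom.hom :=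
    hb''.2.2.2.2.1
  have hpt'' : ∀ a, (AlgPoints.map ε₁''.hom (lvlPtEOf S Kc w e' A₂ lvl₂ y'' a) :
      (fibreΩOf S Kc 𝓜 w e' univ y'').Points (AlgebraicClosure (w.adicCompletion F))) = lvlPtΩOf S Kc 𝓜 w e' univ lvl y'' a :=
    hb''.2.2.2.2.2.2
  exact ⟨K.map φ.toMonoidHom, Literature.AlgebraicGeometry.AbelianSchemes.HeckeLines.mem_map_iff_of_iff_tors φ _ _ htors K hK, roofΩ_of_roofE S Kc 𝓜 w univ act dual pol lvl A₂ ρ₂ D₂ pol₂ lvl₂ e' pChar 𝔞 y y'' ε₁ ε₁''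
    he hlam'' hact hact'' hpt hpt'' φ hφsymm K hroof⟩

set_option maxHeartbeats 400000 in
/-- (ED. 2 helper) **THE HECKE ROOFS AT ONE POINT TRANSPORT** — the body of `HeckeRoofsΩ` at `(e′, N′, rc₁, rc₂, x′)` with the coset∕translate book-keeping ABSTRACTED
(index types `B`, `B₂`, the point `y`, the translate families `y₁ : B → …`, `y₂ : B₂ → …`): from the E-side bundle (injective lines, order∕torsion∕stability, onto, the `t₁`-roofs,
the central `t₂`-roofs) to the spread-side bundle, along the bridge at `y` (★ p848009), its point equivalence `φ` (★ p847813 §1), the lines transport (★ p848473) and the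
two roof helpers above.  The socket `stub_HECKETRANS` is this lemma at `y := u x′`, `y₁ β := u (T_{rc₁ β} x′)`, `y₂ β₂ := u (T_{rc₂ β₂} x′)`.
[cite: Kottwitz1992, §5 pp. 389–391] [cite: HarrisTaylorAMS2001, §III.4, pp. 108–110] [cite: RapoportSmithlingZhang2020Diagonal, §4.1 p. 17, §4.3 (4.23) p. 21] -/
theorem heckeRoofsAt_of_E {F : Type} [Field F] [NumberField F] [IsCMField F] {ι₁ : F →+* ℂ}
    {Jstar : Matrix (Fin 2) (Fin 2) F}
    {K₀ : C5.OpenCompactSubgroup ↥(finAdelic ↥(maximalRealSubfield F) F (IsCMField.complexConj F) 2 Jstar)}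
    (S : RecordSystemGS F Jstar ι₁ K₀)
    {Fi : Type} [Field Fi] [NumberField Fi] [Algebra F Fi] (Kc : C5.SmallLevel K₀)
    (𝓜 : IntegralModel (𝓞 F) F ((thickening F Fi).obj (S.M.obj Kc))) (w : HeightOneSpectrum (𝓞 F))
    (univ : AbelianSchemeOver (𝓜.localise w).total.left) (act : RingAction (𝓞 F) univ) (dual : univ.DualPair)
    (pol : univ.Polarization dual) {g N : ℕ} (lvl : univ.LevelStructure g N)
    (A₂ : AbelianSchemeOver ((baseChange F Fi).obj (S.M.obj Kc)).left) (ρ₂ : RingAction (𝓞 F) A₂) (D₂ : A₂.DualPair)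
    (pol₂ : A₂.Polarization D₂) (lvl₂ : A₂.LevelStructure g N)
    (gen_iso : ∀ (e' : Fi →ₐ[F] AlgebraicClosure (w.adicCompletion F))
      (y : AlgPoints (S.M.obj Kc) (AlgebraicClosure (w.adicCompletion F))),
      letI ιη := (𝓜.localise w).genericIso'.inv.left ≫
        pullback.fst (𝓜.localise w).total.hom
          (Literature.NumberTheory.EllipticCurves.specGenericPoint (HeightOneSpectrum.valuationSubringAtPrime F w) F)
      TupleIsoAt₂ (thickeningLift e' (S.M.obj Kc) y).left
        (univ.baseChange ιη) (act.baseChange ιη) (dual.baseChange ιη) (pol.baseChange ιη) (lvl.baseChange ιη)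
        A₂ ρ₂ D₂ pol₂ lvl₂)
    (e' : Fi →ₐ[F] AlgebraicClosure (w.adicCompletion F)) (pChar fDeg : ℕ) (𝔠 𝔞 : Ideal (𝓞 F)) {B B₂ : Type*}
    (y : AlgPoints (S.M.obj Kc) (AlgebraicClosure (w.adicCompletion F))) (y₁ : B → AlgPoints (S.M.obj Kc) (AlgebraicClosure (w.adicCompletion F))) (y₂ : B₂ → AlgPoints (S.M.obj Kc) (AlgebraicClosure (w.adicCompletion F)))
    (hE : ∃ Hβ : B → Subgroup ((fibreEOf S Kc w e' A₂ y).Points (AlgebraicClosure (w.adicCompletion F))),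
      Function.Injective Hβ ∧
      (∀ β, Nat.card ↥(Hβ β) = pChar ^ fDeg ∧ (∀ P ∈ Hβ β, IsIdealTorsionE S Kc w e' A₂ ρ₂ y 𝔠 P) ∧
        ∀ (a : 𝓞 F), ∀ P ∈ Hβ β, (AlgPoints.map (actEOf S Kc w e' A₂ ρ₂ a y).hom.hom.hom P : (fibreEOf S Kc w e' A₂ y).Points (AlgebraicClosure (w.adicCompletion F))) ∈ Hβ β) ∧
      (∀ H' : Subgroup ((fibreEOf S Kc w e' A₂ y).Points (AlgebraicClosure (w.adicCompletion F))),
        Nat.card ↥H' = pChar ^ fDeg → (∀ P ∈ H', IsIdealTorsionE S Kc w e' A₂ ρ₂ y 𝔠 P) →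
        (∀ (a : 𝓞 F), ∀ P ∈ H', (AlgPoints.map (actEOf S Kc w e' A₂ ρ₂ a y).hom.hom.hom P : (fibreEOf S Kc w e' A₂ y).Points (AlgebraicClosure (w.adicCompletion F))) ∈ H') → ∃ β, Hβ β = H') ∧
      (∀ β, ∃ Kβ : Subgroup ((fibreEOf S Kc w e' A₂ y).Points (AlgebraicClosure (w.adicCompletion F))),
        (∀ P, P ∈ Hβ β ↔ P ∈ Kβ ∧ IsIdealTorsionE S Kc w e' A₂ ρ₂ y 𝔠 P) ∧ RoofE S Kc w e' A₂ ρ₂ D₂ pol₂ lvl₂ pChar 𝔞 y (y₁ β) Kβ) ∧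
      (∀ β₂, ∃ K₂ : Subgroup ((fibreEOf S Kc w e' A₂ y).Points (AlgebraicClosure (w.adicCompletion F))),
        (∀ P, P ∈ K₂ ↔ IsIdealTorsionE S Kc w e' A₂ ρ₂ y 𝔠 P) ∧ RoofE S Kc w e' A₂ ρ₂ D₂ pol₂ lvl₂ pChar 𝔞 y (y₂ β₂) K₂)) :
    ∃ HΩ : B → Subgroup ((fibreΩOf S Kc 𝓜 w e' univ y).Points (AlgebraicClosure (w.adicCompletion F))),
      Function.Injective HΩ ∧
      (∀ β, Nat.card ↥(HΩ β) = pChar ^ fDeg ∧ (∀ P ∈ HΩ β, IsIdealTorsionΩ S Kc 𝓜 w e' univ act y 𝔠 P) ∧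
        ∀ (a : 𝓞 F), ∀ P ∈ HΩ β, (AlgPoints.map (actΩOf S Kc 𝓜 w e' univ act a y).hom.hom.hom P : (fibreΩOf S Kc 𝓜 w e' univ y).Points (AlgebraicClosure (w.adicCompletion F))) ∈ HΩ β) ∧
      (∀ H' : Subgroup ((fibreΩOf S Kc 𝓜 w e' univ y).Points (AlgebraicClosure (w.adicCompletion F))),
        Nat.card ↥H' = pChar ^ fDeg → (∀ P ∈ H', IsIdealTorsionΩ S Kc 𝓜 w e' univ act y 𝔠 P) →
        (∀ (a : 𝓞 F), ∀ P ∈ H', (AlgPoints.map (actΩOf S Kc 𝓜 w e' univ act a y).hom.hom.hom P : (fibreΩOf S Kc 𝓜 w e' univ y).Points (AlgebraicClosure (w.adicCompletion F))) ∈ H') → ∃ β, HΩ β = H') ∧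
      (∀ β, ∃ Kβ : Subgroup ((fibreΩOf S Kc 𝓜 w e' univ y).Points (AlgebraicClosure (w.adicCompletion F))),
        (∀ P, P ∈ HΩ β ↔ P ∈ Kβ ∧ IsIdealTorsionΩ S Kc 𝓜 w e' univ act y 𝔠 P) ∧ RoofΩ S Kc 𝓜 w e' univ act dual pol lvl pChar 𝔞 y (y₁ β) Kβ) ∧
      (∀ β₂, ∃ K₂ : Subgroup ((fibreΩOf S Kc 𝓜 w e' univ y).Points (AlgebraicClosure (w.adicCompletion F))),
        (∀ P, P ∈ K₂ ↔ IsIdealTorsionΩ S Kc 𝓜 w e' univ act y 𝔠 P) ∧ RoofΩ S Kc 𝓜 w e' univ act dual pol lvl pChar 𝔞 y (y₂ β₂) K₂) := by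
  refine hE.elim fun Hβ hH => ?_
  -- THE BRIDGE at `y` (★ p848009): exact on `λ` (both ways), on `ι` (both ways), on the level points (both ways)
  refine (gen_iso e' y).elim fun G hG₁ => hG₁.elim fun Ĝ hG => ?_
  refine (Literature.AlgebraicGeometry.AbelianSchemes.AbelianSchemeOver.exists_iso_exact_of_tupleRel_id_point (thickeningLift e' (S.M.obj Kc) y).left (univ.baseChange ((𝓜.localise w).genericIso'.inv.left ≫ CategoryTheory.Limits.pullback.fst (𝓜.localise w).total.hom (Literature.NumberTheory.EllipticCurves.specGenericPoint (HeightOneSpectrum.valuationSubringAtPrime F w) F))) A₂ (act.baseChange ((𝓜.localise w).genericIso'.inv.left ≫ CategoryTheory.Limits.pullback.fst (𝓜.localise w).total.hom (Literature.NumberTheory.EllipticCurves.specGenericPoint (HeightOneSpectrum.valuationSubringAtPrime F w) F))) ρ₂ (dual.baseChange ((𝓜.localise w).genericIso'.inv.left ≫ CategoryTheory.Limits.pullback.fst (𝓜.localise w).total.hom (Literature.NumberTheory.EllipticCurves.specGenericPoint (HeightOneSpectrum.valuationSubringAtPrime F w) F))) D₂ (pol.baseChange ((𝓜.localise w).genericIso'.inv.left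 ≫ CategoryTheory.Limits.pullback.fst (𝓜.localise w).total.hom (Literature.NumberTheory.EllipticCurves.specGenericPoint (HeightOneSpectrum.valuationSubringAtPrime F w) F))) pol₂ (lvl.baseChange ((𝓜.localise w).genericIso'.inv.left ≫ CategoryTheory.Limits.pullback.fst (𝓜.localise w).total.hom (Literature.NumberTheory.EllipticCurves.specGenericPoint (HeightOneSpectrum.valuationSubringAtPrime F w) F))) lvl₂ hG).elim fun ε hε => hε.elim fun hmon hb => ?_
  haveI := hmon
  let ε₁ : (schEOf S Kc w e' A₂ y).X ≅ (schΩOf S Kc 𝓜 w e' univ y).X := ε.symm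
  haveI hε₁ : IsMonHom ε₁.hom := (inferInstance : IsMonHom ε.inv)
  have hlam : ε₁.hom ≫ (polΩOf S Kc 𝓜 w e' univ pol y).lam ≫
      Literature.AlgebraicGeometry.AbelianSchemes.AbelianSchemeOver.DualPair.dualIsogenyOver ε₁.hom (dualEOf S Kc w e' A₂ D₂ y)
        (dualΩOf S Kc 𝓜 w e' univ dual y) = (polEOf S Kc w e' A₂ pol₂ y).lam := hb.2.2.1
  have hact₁ : ∀ a, (actEOf S Kc w e' A₂ ρ₂ a y).hom.hom.hom ≫ ε₁.hom = ε₁.hom ≫ (actΩOf S Kc 𝓜 w e' univ act a y).hom.hom.hom :=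
    hb.2.2.2.2.1
  have hpt : ∀ a, (AlgPoints.map ε₁.hom (lvlPtEOf S Kc w e' A₂ lvl₂ y a) :
      (fibreΩOf S Kc 𝓜 w e' univ y).Points (AlgebraicClosure (w.adicCompletion F))) = lvlPtΩOf S Kc 𝓜 w e' univ lvl y a :=
    hb.2.2.2.2.2.2
  -- the induced multiplicative equivalence of point groups `φ : E_{e′,y}(Ω) ≃* 𝒯_{e′,y}(Ω)` (★ p847813 §1)
  refine (Literature.AlgebraicGeometry.AbelianSchemes.AbelianSchemeOver.exists_mulEquiv_points_of_iso ε₁).elim fun φ hφ => ?_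
  -- torsion predicates and actions correspond under `φ`
  have htors : ∀ (𝔡 : Ideal (𝓞 F)) (P : (fibreEOf S Kc w e' A₂ y).Points (AlgebraicClosure (w.adicCompletion F))),
      IsIdealTorsionΩ S Kc 𝓜 w e' univ act y 𝔡 (φ P) ↔ IsIdealTorsionE S Kc w e' A₂ ρ₂ y 𝔡 P := fun 𝔡 P => by
    rw [hφ.1]
    exact (Literature.AlgebraicGeometry.AbelianSchemes.AbelianSchemeOver.forall_map_eq_one_iff_of_iso ε₁ (· ∈ 𝔡)
      (fun a => (actEOf S Kc w e' A₂ ρ₂ a y).hom.hom.hom) (fun a => (actΩOf S Kc 𝓜 w e' univ act a y).hom.hom.hom) hact₁ P).symm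
  have hactφ : ∀ (a : 𝓞 F) (P : (fibreEOf S Kc w e' A₂ y).Points (AlgebraicClosure (w.adicCompletion F))),
      (AlgPoints.map (actΩOf S Kc 𝓜 w e' univ act a y).hom.hom.hom (φ P) : (fibreΩOf S Kc 𝓜 w e' univ y).Points (AlgebraicClosure (w.adicCompletion F))) =
        φ (AlgPoints.map (actEOf S Kc w e' A₂ ρ₂ a y).hom.hom.hom P) := fun a P => by
    rw [hφ.1, hφ.1]
    exact (AlgPoints.map_comp_apply ε₁.hom (actΩOf S Kc 𝓜 w e' univ act a y).hom.hom.hom P).symm.trans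
      ((congrArg (fun f => AlgPoints.map f P) (hact₁ a).symm).trans
        (AlgPoints.map_comp_apply (actEOf S Kc w e' A₂ ρ₂ a y).hom.hom.hom ε₁.hom P))
  -- (a)(b)(c) THE LINES along `φ` (★ p848473)
  have hL := Literature.AlgebraicGeometry.AbelianSchemes.HeckeLines.lines_transport φ
    (IsIdealTorsionE S Kc w e' A₂ ρ₂ y 𝔠) (IsIdealTorsionΩ S Kc 𝓜 w e' univ act y 𝔠)
    (fun a P => AlgPoints.map (actEOf S Kc w e' A₂ ρ₂ a y).hom.hom.hom P)
    (fun a Q => AlgPoints.map (actΩOf S Kc 𝓜 w e' univ act a y).hom.hom.hom Q)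
    (htors _) hactφ Hβ hH.1 hH.2.1 hH.2.2.1
  -- (d)(e) THE ROOFS (helpers above)
  exact ⟨fun β => (Hβ β).map φ.toMonoidHom, hL.1, hL.2.1, hL.2.2,
    fun β => (hH.2.2.2.1 β).elim fun Kβ hK =>
      lineRoofΩ_of_E S Kc 𝓜 w univ act dual pol lvl A₂ ρ₂ D₂ pol₂ lvl₂ gen_iso e' pChar 𝔠 𝔞 y (y₁ β) ε₁ hlam hact₁ hpt φ hφ.2 (htors _)
        Kβ (Hβ β) hK.1 hK.2,
    fun β₂ => (hH.2.2.2.2 β₂).elim fun K₂ hK =>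
      centralRoofΩ_of_E S Kc 𝓜 w univ act dual pol lvl A₂ ρ₂ D₂ pol₂ lvl₂ gen_iso e' pChar 𝔠 𝔞 y (y₂ β₂) ε₁ hlam hact₁ hpt φ hφ.2 (htors _)
        K₂ hK.1 hK.2⟩

set_option maxHeartbeats 400000 in
/-- **SOCKET `stub_HECKETRANS`** (LEAD heir F0P6-plan (g3) 02:14:48Z (B), token ask): the Hecke-roofs transport letter BY VALUE — PAID IN-LINE (per-point core ★ p847813 `roof_transport_along_iso`
(LA4-p02), bridge ★ p848009, lines ★ p848473 `HeckeLines.lines_transport`, helper `roofΩ_of_roofE` (LA4-p01)). [cite: Kottwitz1992, §5 pp. 389–391] [cite: RapoportSmithlingZhang2020Diagonal, §4.3 (4.23) p. 21] -/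
theorem stub_HECKETRANS : RecordHeckeTransport := by
  intro F _ _ _ ι₁ Jstar K₀ S hU7ₛ hJ hJu Fi _ _ _ Kc 𝓜 w hw univ act dual pol g N lvl A₂ ρ₂ D₂ pol₂ lvl₂ gen_iso pChar fDeg hE
    e' N' hN'Kc rc₁ hrc₁ hrcN₁ rc₂ hrc₂ hrcN₂ x'
  exact heckeRoofsAt_of_E S Kc 𝓜 w univ act dual pol lvl A₂ ρ₂ D₂ pol₂ lvl₂ gen_iso e' pChar fDeg
    ((IsCMField.complexConj F) • w).asIdeal w.asIdeal (AlgPoints.map (S.M.map (CategoryTheory.homOfLE hN'Kc)) x')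
    (fun β => AlgPoints.map (recordHeckeTranslateGS S hU7ₛ (rc₁ β) N' Kc (hrcN₁ β)) x')
    (fun β₂ => AlgPoints.map (recordHeckeTranslateGS S hU7ₛ (rc₂ β₂) N' Kc (hrcN₂ β₂)) x')
    (hE e' N' hN'Kc rc₁ hrc₁ hrcN₁ rc₂ hrc₂ hrcN₂ x')

end Summit.HodgeConjecture.HodgeConjecture.Cruxes.HLiu418.F0P6aEReadings
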